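import Mathlib
import HarnessLib
import Literature.Analysis.FluidPDE.ClassicalSolution
import Literature.Analysis.FluidPDE.VectorCalculus
import Literature.Analysis.FluidPDE.NSBoundedMildOseen
import Literature.Analysis.UnboundedOperators.HeatKernel
import Summits.NavierStokesRegularity.NavierStokesRegularity.Theorems.UnthreadedRigidityDoorUnthreadedRigidityProfileHornDefs

/-!
# Route `UnthreadedRigidityDoor`, item `UnthreadedRigidity` (W2, stmt-NavierStokesRegularity-27585) — LINE g10-1 «PRESSURE HORN» (+ TOWER THEOREM)
# (planner ns-idea-6 g10; idea-crit-4 g7 PASS, no price, 2026-08-29T02:16:06Z; v1.1 N1-typed): THE TYPED OBJECTS AND STATEMENTS of the line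
# (Theorems-side twin of the sketch)

Definition file — Theorems-side twin of the files-only line sketch `pub/ideators/ns-idea-6/lines/UnthreadedRigidityDoor/PressureHorn_sketch.lean`
(v1.1, 446 l., sha16 718574a690823eb1, `lean check` rc 0 / 0 sorry; CARD `PressureHorn_CARD.md`), namespace `…Theorems.UnthreadedRigidity.PressureHorn` instead of
the sketch's `…Cruxes.UnthreadedRigidity.PressureHorn`.  Every def BODY below is VERBATIM from the sketch; the objects the sketch shares VERBATIM with LINE
g10-2 «PROFILE HORN» (`E3`, `threadingFlux`, `IsSliceAxisymmetric`, `IsQuadForm`, `quadY`, `sepShell`, `HornAdmissible`, `discrCubic`, `IsZonalForm`,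
`vortAmp`, `strainAmp`, `aTwo`, `aFour`, `innerMoment`, `outerMoment`, `eulerPressure`, `hornBracket`, `ProfileHornRigidity`,
`SeparableShellOrderTwoRigidity`) are NOT re-declared: they are the decls of the landed g10-2 twin `…Theorems.UnthreadedRigidity.ProfileHorn`
(`UnthreadedRigidityDoorUnthreadedRigidityProfileHornDefs.lean`, p689891, ns-crc-p1 g7), opened below, so both horns speak one language and g10-2's
landed theorems (`profileHornRigidity_holds` p692614, `zonalSepShellAxisymUniform_holds` p690562) plug into this line's compositions by name.  The
sketch's `import …Theses.UnthreadedRigidityDoor` is dropped (no body here uses a Theses symbol; the composition `isotypicWindowRigidity_of_crux` lives in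
the compositions file).  Filed Theorems-side by the K2 hand ns-poloidal-K2-p2 g13 (DIRECTOR-NS KEY-NS #186 / #281); author of the statements: planner
ns-idea-6 g10.

THE LINE (sketch docstring, abridged).  Free the FORM as well as the profile: the general smooth `l = 2`-ISOTYPIC poloidal datum about `x₀` is
`u₀ = curl curl (Y_{Q(|y|)}(y)·y)`, `y = x − x₀`, `r ↦ Q(r) ∈ V₂` a radial FAMILY of trace-free symmetric forms (five radial profiles).  (1) ORDER ONE IS A
WRONSKIAN (COROLLARY DP2, exact, kit j321686): `c₁(x₀ + r y) = −24 r⁻³ ∂_r(r⁶·det[y, Q(r)y, Q′(r)y])`; silence at order one forces `Q ∧ Q′ ≡ 0` — the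
datum is PIECEWISE SEPARABLE, a tower of nested single-form shells.  (2) ORDER TWO on one separable piece is g10-2's PROFILE HORN (THEOREM PHR).  (3) The
nested multi-form tower talks only through harmonic pressure multipoles and collapses from the outside in (TOWER THEOREM: F1 `𝒢(Q) = ℝ·P(Q)`, F2
`P(Q′) ∥ P(Q) ⇒ Q′ = ±sQ`, exact kit j322447/j322497; ROW DS j321609) for every FINITE tower (`NestedHornExclusionFinite`); the residual X∞ (infinitely
many flat-joined pieces) is slice-level only — on an analytic WINDOW the wedge identity gives global separability at once and the `l = 2`-isotypic case of
27585 reduces completely to typed obligations (`isotypicWindowRigidity_of_horns`, compositions file).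

Objects: `isoShell`, `radDeriv`, `IsoAdmissible`, `wedgeDet`, `WedgeVanishes`, `IsFiniteTower`.  Statements: `IsotypicOrderOneIdentity` (BRIDGE DP2, M–L),
`EulerVanishing` (S), `IsotypicOrderOneRigidity` (rung I1), `NestedHornExclusion` (crux X, residual X∞), `FiniteTowerWedge` (S-T),
`NestedHornExclusionFinite` (T = the TOWER THEOREM's statement), `IsotypicOrderTwoRigidity` (rung I2), `IsotypicWindowRigidity` (rung IW = 27585 on
isotypic windows), `WindowWedgeAnalytic` (BRIDGE W, M), `AnalyticWedgeSeparable` (S), `HornWindowSilenceVar` (BRIDGE PH-W′, M–L), `ZonalSepShellAxisym`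
(S-Z′), `WindowAxisUniform` (S-U, S–M).  TYPING NOTES (sketch): matrix-valued radial families are handled ENTRYWISE (no norm instance on `Matrix`);
jets one-sided as in g9/g10-2; no instances, no notation.

WHAT THIS IS NOT: no NS-regularity statement is touched; `UnthreadedRigidity` (27585), W2 and NS regularity stay OPEN; these are the objects of one
line on the wall item (the conjectural bridges among them are labelled so in their docstrings); nobody here claims `UnthreadedRigidity`.
`--supports stmt-NavierStokesRegularity-27585 --as helper`.  [cite: MajdaBertozziCUP2002, §1.1 (vector identities); LemarieRieusset2016 (mild
formulation)]
-/

-- the summit and its single sub-problem share the name (CONVENTIONS §1)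
set_option linter.dupNamespace false

namespace Summit.NavierStokesRegularity.NavierStokesRegularity.Theorems.UnthreadedRigidity.PressureHorn

open scoped Topology
open Filter Set MeasureTheory
open Summit.NavierStokesRegularity.NavierStokesRegularity.Theorems.UnthreadedRigidity.ProfileHorn

/-- the `l = 2`-ISOTYPIC poloidal datum about `x₀` generated by a radial family of forms `Q : ℝ → V₂`:
`u₀ = curl curl ( Y_{Q(|y|)}(y) · y )` (five radial profiles; separable iff `Q(r) = H(r)·Q₀`). -/
noncomputable def isoShell (Q : ℝ → Matrix (Fin 3) (Fin 3) ℝ) (x₀ : E3) : E3 → E3 :=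
  Literature.Analysis.FluidPDE.curl (Literature.Analysis.FluidPDE.curl
    (fun x : E3 => (quadY (Q ‖x - x₀‖) (x - x₀)) • (x - x₀)))

/-- entrywise radial derivative of a family of forms. -/
noncomputable def radDeriv (Q : ℝ → Matrix (Fin 3) (Fin 3) ℝ) (r : ℝ) : Matrix (Fin 3) (Fin 3) ℝ :=
  Matrix.of fun i j => deriv (fun s => Q s i j) r

/-- ADMISSIBLE families: traceless symmetric, `Q(r) = q(r²)` with `q` entrywise smooth, entrywise decay `r⁵|Q|, r⁶|Q′|, r⁷|Q″| ≤ C` on `[1,∞)`. -/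
def IsoAdmissible (Q : ℝ → Matrix (Fin 3) (Fin 3) ℝ) : Prop :=
  (∀ r, 0 ≤ r → IsQuadForm (Q r)) ∧
  (∃ q : ℝ → Matrix (Fin 3) (Fin 3) ℝ, (∀ i j, ContDiff ℝ (⊤ : ℕ∞) (fun s => q s i j)) ∧ ∀ r, 0 ≤ r → Q r = q (r ^ 2)) ∧
  ∃ C : ℝ, ∀ r, 1 ≤ r → ∀ i j,
    r ^ 5 * |Q r i j| ≤ C ∧ r ^ 6 * |deriv (fun s => Q s i j) r| ≤ C ∧ r ^ 7 * |deriv (deriv (fun s => Q s i j)) r| ≤ C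

/-- the WEDGE CUBIC `det[y, Ay, By]` — the (injective) equivariant image of `A ∧ B ∈ Λ²V₂ ≅ V₃ ⊕ V₁` in the cubics (COROLLARY DP2: the angular factor
of the order-one cross term of two forms is `−4·det[y, Q₁y, Q₂y]`, exact on five form pairs incl. a generic one, kit j321686). -/
noncomputable def wedgeDet (A B : Matrix (Fin 3) (Fin 3) ℝ) (y : E3) : ℝ :=
  Matrix.det (Matrix.of ![fun i => y i, A.mulVec (fun i => y i), B.mulVec (fun i => y i)])

/-- «PIECEWISE SEPARABLE»: `Q(r) ∧ Q′(r) = 0` for every `r > 0` (read through the wedge cubic on the unit sphere). -/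
def WedgeVanishes (Q : ℝ → Matrix (Fin 3) (Fin 3) ℝ) : Prop :=
  ∀ r : ℝ, 0 < r → ∀ y : E3, ‖y‖ = 1 → wedgeDet (Q r) (radDeriv Q r) y = 0

/-- BRIDGE DP2 «ORDER ONE IS THE WRONSKIAN» (M–L; exact slice algebra kit j321686 + locality of the first jet): for the classical solution on `[t₀,T)`
issuing from an admissible isotypic datum, the one-sided first threading jet at `x₀ + r·y` (`|y| = 1`, `r > 0`) is
`−24 r⁻³ · d/dr ( r⁶ det[y, Q(r)y, Q′(r)y] )`.  (Pressure-free.)  WHY IT MIGHT FAIL: only the M-part (one-sided smoothness; formal jet = jet). -/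
def IsotypicOrderOneIdentity : Prop :=
  ∀ (t₀ T : ℝ) (u : ℝ → E3 → E3) (p : ℝ → E3 → ℝ) (x₀ : E3) (Q : ℝ → Matrix (Fin 3) (Fin 3) ℝ),
    t₀ < T →
    Literature.Analysis.FluidPDE.IsClassicalNSSolutionOn (Set.Ico t₀ T) 1 0 u p →
    IsoAdmissible Q → u t₀ = isoShell Q x₀ →
    ∀ r : ℝ, 0 < r → ∀ y : E3, ‖y‖ = 1 →
      derivWithin (fun t => threadingFlux u x₀ t (x₀ + r • y)) (Set.Ici t₀) t₀
        = -24 * r⁻¹ ^ 3 * deriv (fun s => s ^ 6 * wedgeDet (Q s) (radDeriv Q s) y) r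

/-- S-E (support, S; provable now — Euler ODE): if `d/dr (r⁶ w(r)) = 0` on `(0,∞)` for the smooth-even bounded `w(r) = det[y,Q(r)y,Q′(r)y]`, then
`r⁶ w` is constant and the constant is its limit `0` at `r = 0⁺`. -/
def EulerVanishing : Prop :=
  ∀ (Q : ℝ → Matrix (Fin 3) (Fin 3) ℝ) (y : E3), IsoAdmissible Q →
    (∀ r : ℝ, 0 < r → deriv (fun s => s ^ 6 * wedgeDet (Q s) (radDeriv Q s) y) r = 0) →
    ∀ r : ℝ, 0 < r → wedgeDet (Q r) (radDeriv Q r) y = 0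

/-- RUNG I1 «ISOTYPIC ORDER-ONE RIGIDITY» (all five profiles free): vanishing first one-sided threading jet ⇒ the datum is piecewise separable. -/
def IsotypicOrderOneRigidity : Prop :=
  ∀ (t₀ T : ℝ) (u : ℝ → E3 → E3) (p : ℝ → E3 → ℝ) (x₀ : E3) (Q : ℝ → Matrix (Fin 3) (Fin 3) ℝ),
    t₀ < T →
    Literature.Analysis.FluidPDE.IsClassicalNSSolutionOn (Set.Ico t₀ T) 1 0 u p →
    IsoAdmissible Q → u t₀ = isoShell Q x₀ →
    (∀ x : E3, derivWithin (fun t => threadingFlux u x₀ t x) (Set.Ici t₀) t₀ = 0) →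
    WedgeVanishes Q

/-- CRUX X «NESTED HORN EXCLUSION» (the surviving counterexample, typed as the statement that kills it): a piecewise-separable admissible isotypic datum
whose first AND second one-sided threading jets vanish is globally separable (one form, one admissible profile).
STATUS (g10, 2026-08-29): PROVED ON PAPER FOR EVERY CONFIGURATION WITH FINITELY MANY PIECES — the TOWER THEOREM of the CARD: on the annulus of piece
`k` the order-two jet is `K_k·[ W̃_k r³ D_k − 4 r⁵ {Y_k, G_out} + 3 r⁻² {Y_k, 𝒮₂} + 5 r⁻⁴ {Y_k, 𝒮₄} ]` (self = PROFILE HORN; cross terms through the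
harmonic pressure only; operator identity `x·curl(ω_k × ∇G) = −4K_k{Y_k,G}` exact for symbolic profile, kit j322497 P0), where
`G_out = Σ_{J outside k} β₄^{(J)} P(Q_J)`, `β₄^{(J)} = (40/3)∫H_J′²/ρ > 0`, `P(Q) = proj_{H₄}(Y_Q²)`; radial independence forces `G_out ∈ 𝒢(Q_k)`;
(F1) `𝒢(Q) := {G ∈ H₄ : {Y_Q, G} ∈ ℝ·r²D_Q} = ℝ·P(Q)` for EVERY form `Q ≠ 0` (exact: even Klein sector by hand + gcd of maximal minors = 1 in `t`,
odd sectors injective with Gram determinants > 0 on ℝ, zonal case dim 1 — kit j322447 PART 1/1z, j322497 P1′); (F2) `P(Q′) ∥ P(Q) ⇒ Q′ = ±sQ`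
(exact: the lex Gröbner basis over ℚ[t, q, c] contains `c·q₁₂, c·q₁₃, c·q₂₃, c·(t q₁₁ − q₂₂), c·(q₁₁² − c)` — ideal membership, valid for every `t` —
kit j322497 P2′); induction from the outermost piece inward (`β > 0` keeps every partial sum a POSITIVE multiple) ⇒ all forms proportional
⇒ separable.  RESIDUAL (why it might still fail as typed): infinitely many pieces with flat junctions (no outermost piece / dense order type) — an
exotic `C^∞` configuration; impossible for analytic slices (window level, where `AnalyticWedgeSeparable` applies). -/
def NestedHornExclusion : Prop :=
  ∀ (t₀ T : ℝ) (u : ℝ → E3 → E3) (p : ℝ → E3 → ℝ) (x₀ : E3) (Q : ℝ → Matrix (Fin 3) (Fin 3) ℝ),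
    t₀ < T →
    Literature.Analysis.FluidPDE.IsClassicalNSSolutionOn (Set.Ico t₀ T) 1 0 u p →
    (∀ t ∈ Set.Ico t₀ T, Tendsto (p t) (cocompact E3) (𝓝 0)) →
    IsoAdmissible Q → u t₀ = isoShell Q x₀ →
    (∀ x : E3, derivWithin (fun t => threadingFlux u x₀ t x) (Set.Ici t₀) t₀ = 0) →
    (∀ x : E3, iteratedDerivWithin 2 (fun t => threadingFlux u x₀ t x) (Set.Ici t₀) t₀ = 0) →
    WedgeVanishes Q →
    ∃ (H : ℝ → ℝ) (Q₀ : Matrix (Fin 3) (Fin 3) ℝ), HornAdmissible H ∧ IsQuadForm Q₀ ∧ u t₀ = sepShell H Q₀ x₀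

/-- FINITE TOWERS (critic N1, 02:16Z): `Q` is a finite sum of separable pieces `H_k • Q_k` whose admissible radial profiles vanish off
pairwise disjoint radial intervals `(a_k, b_k)` (flat junctions are automatic: each `H_k` is smooth through `r ↦ h_k(r²)`). -/
def IsFiniteTower (Q : ℝ → Matrix (Fin 3) (Fin 3) ℝ) : Prop :=
  ∃ (N : ℕ) (Hk : Fin N → ℝ → ℝ) (Qk : Fin N → Matrix (Fin 3) (Fin 3) ℝ) (a b : Fin N → ℝ),
    (∀ k, HornAdmissible (Hk k) ∧ IsQuadForm (Qk k) ∧ 0 ≤ a k ∧ a k < b k) ∧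
    (∀ j k, j ≠ k → b j ≤ a k ∨ b k ≤ a j) ∧
    (∀ k (r : ℝ), 0 ≤ r → (r ≤ a k ∨ b k ≤ r) → Hk k r = 0) ∧
    ∀ r : ℝ, 0 ≤ r → Q r = ∑ k, Hk k r • Qk k

/-- OBLIGATION S-T «A FINITE TOWER IS PIECEWISE SEPARABLE» (S): on each annulus `Q = H_k • Q_k`, `Q′ = H_k′ • Q_k`, so `det[y, Qy, Q′y]` has two
proportional columns; off the supports `Q ≡ 0` near `r` (or `r` is a flat junction where `Q r = 0`). -/
def FiniteTowerWedge : Prop :=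
  ∀ Q : ℝ → Matrix (Fin 3) (Fin 3) ℝ, IsoAdmissible Q → IsFiniteTower Q → WedgeVanishes Q

/-- TARGET T «NESTED HORN EXCLUSION — FINITE TOWERS» (critic N1): `NestedHornExclusion` restricted to finite towers.  THIS is the statement the
paper TOWER THEOREM proves (F1/F2 exact + outside-in induction, `β_J = (40/3)∫H_J′²/ρ > 0`); it carries no X∞ residual and can land as a T-item. -/
def NestedHornExclusionFinite : Prop :=
  ∀ (t₀ T : ℝ) (u : ℝ → E3 → E3) (p : ℝ → E3 → ℝ) (x₀ : E3) (Q : ℝ → Matrix (Fin 3) (Fin 3) ℝ),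
    t₀ < T →
    Literature.Analysis.FluidPDE.IsClassicalNSSolutionOn (Set.Ico t₀ T) 1 0 u p →
    (∀ t ∈ Set.Ico t₀ T, Tendsto (p t) (cocompact E3) (𝓝 0)) →
    IsoAdmissible Q → u t₀ = isoShell Q x₀ →
    (∀ x : E3, derivWithin (fun t => threadingFlux u x₀ t x) (Set.Ici t₀) t₀ = 0) →
    (∀ x : E3, iteratedDerivWithin 2 (fun t => threadingFlux u x₀ t x) (Set.Ici t₀) t₀ = 0) →
    IsFiniteTower Q →
    ∃ (H : ℝ → ℝ) (Q₀ : Matrix (Fin 3) (Fin 3) ℝ), HornAdmissible H ∧ IsQuadForm Q₀ ∧ u t₀ = sepShell H Q₀ x₀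

/-- TARGET RUNG I2 «ISOTYPIC ORDER-TWO RIGIDITY»: the whole `l = 2`-isotypic sector is decided at jet depth two — an admissible isotypic datum,
left-end slice of a classical solution with decaying pressure, with vanishing first and second one-sided threading jets, is an axisymmetric slice. -/
def IsotypicOrderTwoRigidity : Prop :=
  ∀ (t₀ T : ℝ) (u : ℝ → E3 → E3) (p : ℝ → E3 → ℝ) (x₀ : E3) (Q : ℝ → Matrix (Fin 3) (Fin 3) ℝ),
    t₀ < T →
    Literature.Analysis.FluidPDE.IsClassicalNSSolutionOn (Set.Ico t₀ T) 1 0 u p →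
    (∀ t ∈ Set.Ico t₀ T, Tendsto (p t) (cocompact E3) (𝓝 0)) →
    IsoAdmissible Q → u t₀ = isoShell Q x₀ →
    (∀ x : E3, derivWithin (fun t => threadingFlux u x₀ t x) (Set.Ici t₀) t₀ = 0) →
    (∀ x : E3, iteratedDerivWithin 2 (fun t => threadingFlux u x₀ t x) (Set.Ici t₀) t₀ = 0) →
    IsSliceAxisymmetric (u t₀) x₀

/-- WINDOW RUNG «ISOTYPIC WINDOW RIGIDITY» = the crux 27585 with its hypotheses VERBATIM, restricted to windows all of whose slices are admissible
`l = 2`-isotypic poloidal data about `x₀` (a time-dependent radial family of forms allowed).  Bears on 27585 by name (composition below); its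
reduction to the slice rungs needs the window→slice bridge (interior regularity, `windowAnalytic`) and is NOT composed here. -/
def IsotypicWindowRigidity : Prop :=
  ∀ (S : Set ℝ), IsOpen S → IsPreconnected S → ∀ (u : ℝ → E3 → E3) (x₀ : E3),
    ContinuousOn (Function.uncurry u) (S ×ˢ Set.univ) →
    (∀ t ∈ S, Literature.Analysis.FluidPDE.VectorCalculus.IsDivFree (u t)) →
    (∀ s ∈ S, ∀ t ∈ S, s < t → ∀ x, u t x =
        Literature.Analysis.UnboundedOperators.heatExtension (u s) (t - s) x
          - Literature.Analysis.FluidPDE.oseenDuhamel 1 s u u t x) →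
    (∀ τ ∈ S, ∃ B : ℝ, ∀ t ∈ S, t ≤ τ → ∀ x, ‖u t x‖ ≤ B) →
    (∀ t ∈ S, ∀ x, inner ℝ (Literature.Analysis.FluidPDE.curl (u t) x) (x - x₀) = 0) →
    (∀ t ∈ S, ∃ Q : ℝ → Matrix (Fin 3) (Fin 3) ℝ, IsoAdmissible Q ∧ u t = isoShell Q x₀) →
    ∃ A : E3 →L[ℝ] E3, (∀ x, inner ℝ (A x) x = 0) ∧ A ≠ 0 ∧
      ∀ t ∈ S, ∀ x, fderiv ℝ (u t) x (A (x - x₀)) - A (u t x) = 0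

/-- BRIDGE W «WINDOW WEDGE + ANALYTICITY» (M: interior space-analyticity of bounded mild solutions ⇒ `r ↦ Q_t(r)` analytic on `(0,∞)`
(`Q_t` is read off `x·u(t) = 6·Y_{Q_t(|y|)}(y)` by angular integration); the flux is ≡ 0 in the window so its (two-sided = one-sided) first jet
vanishes at every interior time, and DP2 gives the wedge).  WHY IT MIGHT FAIL: only the M-part. -/
def WindowWedgeAnalytic : Prop :=
  ∀ (S : Set ℝ), IsOpen S → ∀ (u : ℝ → E3 → E3) (x₀ : E3),
    ContinuousOn (Function.uncurry u) (S ×ˢ Set.univ) →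
    (∀ t ∈ S, Literature.Analysis.FluidPDE.VectorCalculus.IsDivFree (u t)) →
    (∀ s ∈ S, ∀ t ∈ S, s < t → ∀ x, u t x =
        Literature.Analysis.UnboundedOperators.heatExtension (u s) (t - s) x
          - Literature.Analysis.FluidPDE.oseenDuhamel 1 s u u t x) →
    (∀ τ ∈ S, ∃ B : ℝ, ∀ t ∈ S, t ≤ τ → ∀ x, ‖u t x‖ ≤ B) →
    (∀ t ∈ S, ∀ x, inner ℝ (Literature.Analysis.FluidPDE.curl (u t) x) (x - x₀) = 0) →
    ∀ (Qf : ℝ → ℝ → Matrix (Fin 3) (Fin 3) ℝ),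
    (∀ t ∈ S, IsoAdmissible (Qf t) ∧ u t = isoShell (Qf t) x₀) →
    ∀ t ∈ S, WedgeVanishes (Qf t) ∧ ∀ i j, AnalyticOnNhd ℝ (fun s => Qf t s i j) (Set.Ioi 0)

/-- S-A (support, S; real analysis, provable now): an admissible family, entrywise analytic on `(0,∞)`, with vanishing wedge is GLOBALLY separable
(injectivity of `A ∧ B ↦ det[y,Ay,By]` on `Λ²V₂`; an analytic curve with `Q′ ∥ Q` near a non-zero point stays on that line everywhere). -/
def AnalyticWedgeSeparable : Prop :=
  ∀ (Q : ℝ → Matrix (Fin 3) (Fin 3) ℝ), IsoAdmissible Q →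
    (∀ i j, AnalyticOnNhd ℝ (fun s => Q s i j) (Set.Ioi 0)) → WedgeVanishes Q →
    ∃ (H : ℝ → ℝ) (Q₀ : Matrix (Fin 3) (Fin 3) ℝ), HornAdmissible H ∧ IsQuadForm Q₀ ∧ ∀ r : ℝ, 0 ≤ r → Q r = H r • Q₀

/-- BRIDGE PH-W′ «HORN SILENCE IN A WINDOW, time-dependent form» (M–L; g10-2's `HornWindowSilence` with `Q` allowed to depend on `t`: interior
time-smoothness + THEOREM PH at each slice; poloidal slices are unthreaded so every jet of the flux vanishes). -/
def HornWindowSilenceVar : Prop :=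
  ∀ (S : Set ℝ), IsOpen S → ∀ (u : ℝ → E3 → E3) (x₀ : E3),
    ContinuousOn (Function.uncurry u) (S ×ˢ Set.univ) →
    (∀ t ∈ S, Literature.Analysis.FluidPDE.VectorCalculus.IsDivFree (u t)) →
    (∀ s ∈ S, ∀ t ∈ S, s < t → ∀ x, u t x =
        Literature.Analysis.UnboundedOperators.heatExtension (u s) (t - s) x
          - Literature.Analysis.FluidPDE.oseenDuhamel 1 s u u t x) →
    (∀ τ ∈ S, ∃ B : ℝ, ∀ t ∈ S, t ≤ τ → ∀ x, ‖u t x‖ ≤ B) →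
    ∀ (Hf : ℝ → ℝ → ℝ) (Qf : ℝ → Matrix (Fin 3) (Fin 3) ℝ),
    (∀ t ∈ S, HornAdmissible (Hf t) ∧ IsQuadForm (Qf t) ∧ u t = sepShell (Hf t) (Qf t) x₀) →
    ∀ t ∈ S, IsZonalForm (Qf t) ∨ ∀ r : ℝ, 0 < r → vortAmp (Hf t) r * hornBracket (Hf t) r = 0

/-- S-Z′ (support, S–M): a zonal separable shell is an axisymmetric slice. -/
def ZonalSepShellAxisym : Prop :=
  ∀ (Q : Matrix (Fin 3) (Fin 3) ℝ) (H : ℝ → ℝ) (x₀ : E3), IsQuadForm Q → IsZonalForm Q → HornAdmissible H →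
    IsSliceAxisymmetric (sepShell H Q x₀) x₀

/-- S-U «COMMON AXIS» (support, S–M: forward uniqueness of bounded mild solutions + rotation equivariance ⇒ symmetry axes propagate forward; a
continuous divergence-free field with two distinct symmetry axes through `x₀` is `SO(3)`-equivariant, hence `c·y/|y|³`, hence zero): slicewise
axisymmetry about axes through `x₀` in a window ⇒ one common axis generator. -/
def WindowAxisUniform : Prop :=
  ∀ (S : Set ℝ), IsOpen S → IsPreconnected S → ∀ (u : ℝ → E3 → E3) (x₀ : E3),
    ContinuousOn (Function.uncurry u) (S ×ˢ Set.univ) →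
    (∀ t ∈ S, Literature.Analysis.FluidPDE.VectorCalculus.IsDivFree (u t)) →
    (∀ s ∈ S, ∀ t ∈ S, s < t → ∀ x, u t x =
        Literature.Analysis.UnboundedOperators.heatExtension (u s) (t - s) x
          - Literature.Analysis.FluidPDE.oseenDuhamel 1 s u u t x) →
    (∀ τ ∈ S, ∃ B : ℝ, ∀ t ∈ S, t ≤ τ → ∀ x, ‖u t x‖ ≤ B) →
    (∀ t ∈ S, IsSliceAxisymmetric (u t) x₀) →
    ∃ A : E3 →L[ℝ] E3, (∀ x, inner ℝ (A x) x = 0) ∧ A ≠ 0 ∧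
      ∀ t ∈ S, ∀ x, fderiv ℝ (u t) x (A (x - x₀)) - A (u t x) = 0

end Summit.NavierStokesRegularity.NavierStokesRegularity.Theorems.UnthreadedRigidity.PressureHorn
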